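import Summits.ValiantsHypothesis.ValiantsHypothesis.Theorems.LacunarySymmetroidMatrixDescartesCensusPivotTwoNormalForm
import Summits.ValiantsHypothesis.ValiantsHypothesis.Theorems.LacunarySymmetroidMatrixDescartesCensusPivotIndexRung
import Summits.ValiantsHypothesis.ValiantsHypothesis.Theorems.LacunarySymmetroidMatrixDescartesCensusPivotKit

/-!
# `MatrixDescartes` census — pivot column at `m = 2`: the OPEN CORE of the `2K` law
# (normal-form pivot `diag(−1,1)`, two-sided exponents off the pivot, and EVERY letter active `(Pₖ)₀₀ < (Pₖ)₁₁`)

HONEST FRAMING.  Object-search cell `pub-symmetroid`, Conjecture-B column in PIVOT currency (`…CensusPivotDefs.lean`, seat conjb-1),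
seat `val-sym-mdr-p1` (generation 7).  Helper file landed `--supports` the crux item stmt-ValiantsHypothesis-18050
(`Theses.LacunarySymmetroid.MatrixDescartes`, OPEN, on HOLD) with NO closure claim.  Bookkeeping that says exactly what is
left of the `(2, K)` pivot rows «`Z₊ ≤ 2K`» after `…PivotTwoDefinitePivot` (g6: `det J ≥ 0` settled) and
`…PivotTwoNormalForm` (this seat: `det J < 0` reduces to `J₀ = !![-1,0;0,1]`).  For the normal-form pencil
`F = X^e • J₀ + ∑ₖ X^{dₖ} • Pₖ` (`Pₖ ⪰ 0`), `det F = −X^{2e} + ∑ₖ ((Pₖ)₀₀ − (Pₖ)₁₁) X^{e+dₖ} + ∑_{k≤l} mix X^{dₖ+d_l}` has a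
negative coefficient only at `2e` and at the `e + dₖ` with `(Pₖ)₀₀ < (Pₖ)₁₁` («ACTIVE» letters: more weight on the positive
eigendirection of `J₀`), so by the sign-cell law (val-sym-mdr-p2 g6, Descartes with a negative-support budget):

* `posRoots_le_two_mul_of_inactive`: some letter inactive (`(Pₖ)₁₁ ≤ (Pₖ)₀₀`) and no letter at the pivot exponent ⇒ `Z₊ ≤ 2K`;
* `posRoots_le_two_mul_of_eq_pivot`: some letter AT the pivot exponent (`dₖ = e`) ⇒ `Z₊ ≤ 2K`;
* `posRoots_le_one_of_oneSided`: one-sided exponents ⇒ `Z₊ ≤ 1` (conjb-1's R0 at index one);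
* **`pivotRootLawAt_two_of_core`**: if every CORE pencil — pivot `J₀`, all `dₖ ≠ e`, exponents on both sides of `e`, all
  letters active — has `Z₊ ≤ 2K`, then `PivotRootLawAt 2 K q (2K)` for every `q`.

So the `m = 2` pivot law is open exactly on the core, where Descartes gives `2K + 2` (every one of the `K + 1` negative
coefficients isolated); the scalar form of the core is `…CensusPivotTwoEnvelope` with all `bₖ = β̃ₖ < 0`.
Nothing here bears on `Theses.LacunarySymmetroid.MatrixDescartes` in its window, on `KPlusLogSqLaw`, on `DoorA26` / `DoorA34`,
on the cell's registers or credences, or on `VP ≠ VNP`.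

[folklore] Descartes' rule with a negative-support budget (tree `WLawTwoSignCell.pivotTwo_posRoots_le_signCell`,
`Pivot.TwoDescartes.*`) and conjb-1's `IndexRung.oneSidedIndexRung`.  No definitions, no named facts.
-/

-- `Summit.ValiantsHypothesis.ValiantsHypothesis.…` repeats a component by the D-0017 layout
-- (single-conjunct summit), which the `dupNamespace` linter flags; the name is mandated.
set_option linter.dupNamespace false

namespace Summit.ValiantsHypothesis.ValiantsHypothesis.Theorems.LacunarySymmetroidMatrixDescartes.Pivot.TwoCore

open Matrix Finset Polynomial
open scoped BigOperators
open Pivot.TwoDescartes (letter expo pencil_eq_sum card_posRoots_le_two_mul_card coeff_det_nonneg_of_not_mem)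

variable {K : ℕ}

/-- **Some letter inactive ⇒ `Z₊ ≤ 2K`.**  For the normal-form pencil with PSD letters, no letter at the pivot exponent,
and SOME letter with `(Pₖ)₁₁ ≤ (Pₖ)₀₀`, the determinant has at most `K` negative coefficients, so `Z₊ ≤ 2K`. [folklore] -/
theorem posRoots_le_two_mul_of_inactive (e : ℕ) (d : Fin K → ℕ) (P : Fin K → Matrix (Fin 2) (Fin 2) ℝ)
    (hP : ∀ k, (P k).PosSemidef) (hd : ∀ k, d k ≠ e) (hin : ∃ k, P k 1 1 ≤ P k 0 0) :
    pivotPosRoots e d !![-1, 0; 0, 1] P ≤ 2 * K := by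
  classical
  obtain ⟨k₀, hk₀⟩ := hin
  set A : Finset (Fin K) := Finset.univ.filter (fun k => P k 0 0 < P k 1 1) with hA
  set T : Finset ℕ := insert (e + e) (A.image (fun k => e + d k)) with hT
  have hAcard : A.card ≤ K - 1 := by
    have hsub : A ⊆ Finset.univ.erase k₀ := by
      intro k hk
      rw [Finset.mem_erase]
      refine ⟨?_, Finset.mem_univ _⟩
      rintro rfl
      rw [hA, Finset.mem_filter] at hk
      exact absurd hk.2 (not_lt.2 hk₀)
    have := Finset.card_le_card hsub
    rw [Finset.card_erase_of_mem (Finset.mem_univ _), Finset.card_univ, Fintype.card_fin] at this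
    exact this
  have hTcard : T.card ≤ K := by
    have hK : 1 ≤ K := Nat.succ_le_of_lt (Fin.pos k₀)
    calc T.card ≤ (A.image (fun k => e + d k)).card + 1 := Finset.card_insert_le _ _
      _ ≤ A.card + 1 := Nat.add_le_add_right Finset.card_image_le _
      _ ≤ K - 1 + 1 := Nat.add_le_add_right hAcard _
      _ = K := Nat.sub_add_cancel hK
  have h := WLawTwoSignCell.pivotTwo_posRoots_le_signCell e d !![-1, 0; 0, 1] P hP hd T
    (fun _ => Finset.mem_insert_self _ _)
    (fun k hk => by
      refine Finset.mem_insert_of_mem (Finset.mem_image.2 ⟨k, ?_, rfl⟩)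
      rw [hA, Finset.mem_filter]
      refine ⟨Finset.mem_univ _, ?_⟩
      simp only [Matrix.of_apply, Matrix.cons_val', Matrix.cons_val_zero, Matrix.cons_val_one, Matrix.empty_val',
        Matrix.cons_val_fin_one] at hk
      linarith)
  unfold pivotPosRoots
  exact h.trans (by omega)

/-- **A letter at the pivot exponent ⇒ `Z₊ ≤ 2K`** (any real `2 × 2` pivot letter `J`): the `K + 1` pivot degrees
`e + e`, `e + dₖ` then take at most `K` values, and only they can carry a negative coefficient. [folklore] -/
theorem posRoots_le_two_mul_of_eq_pivot (e : ℕ) (d : Fin K → ℕ) (J : Matrix (Fin 2) (Fin 2) ℝ)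
    (P : Fin K → Matrix (Fin 2) (Fin 2) ℝ) (hP : ∀ k, (P k).PosSemidef) (heq : ∃ k, d k = e) :
    pivotPosRoots e d J P ≤ 2 * K := by
  classical
  obtain ⟨k₀, hk₀⟩ := heq
  set T : Finset ℕ := (Finset.univ : Finset (Fin K)).image (fun k => e + d k) with hT
  have hTcard : T.card ≤ K := le_trans Finset.card_image_le (by simp)
  unfold pivotPosRoots
  rw [pencil_eq_sum]
  have hneg : ∀ n, (Matrix.det (∑ l, ((X : ℝ[X]) ^ expo e d l) • (letter J P l).map Polynomial.C)).coeff n < 0 →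
      n ∈ T := by
    intro n hn
    by_contra hnot
    have hn' : ∀ l, e + expo e d l ≠ n := by
      intro l hl
      rcases l with _ | k
      · exact hnot (Finset.mem_image.mpr ⟨k₀, Finset.mem_univ _, by rw [hk₀]; exact hl⟩)
      · exact hnot (Finset.mem_image.mpr ⟨k, Finset.mem_univ _, hl⟩)
    exact absurd hn (not_lt.mpr (coeff_det_nonneg_of_not_mem e d J P hP n hn'))
  exact (card_posRoots_le_two_mul_card _ T hneg).trans (by omega)

/-- **One-sided exponents ⇒ `Z₊ ≤ 1`** for the normal-form pencil (conjb-1's R0 `oneSidedIndexRung` at index one, with the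
index witness `W = (1, 0)ᵀ` of `…PivotTwoNormalForm`). [folklore] -/
theorem posRoots_le_one_of_oneSided (e : ℕ) (d : Fin K → ℕ) (P : Fin K → Matrix (Fin 2) (Fin 2) ℝ)
    (hP : ∀ k, (P k).PosSemidef) (hone : (∀ k, e ≤ d k) ∨ (∀ k, d k ≤ e)) :
    pivotPosRoots e d !![-1, 0; 0, 1] P ≤ 1 := by
  obtain ⟨W, hW⟩ := TwoNormalForm.normalForm_index (le_refl 1)
  exact IndexRung.oneSidedIndexRung (Fin 2) (Fin K) e d _ P TwoNormalForm.normalForm_isSymm_det.1 hP hone 1 W hW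

/-- With no letters at all (`K = 0`) the pencil `X^e • diag(−1,1)` has `det = −X^{2e}` and no positive root. [folklore] -/
theorem posRoots_eq_zero_of_isEmpty (e : ℕ) (d : Fin 0 → ℕ) (P : Fin 0 → Matrix (Fin 2) (Fin 2) ℝ) :
    pivotPosRoots e d !![-1, 0; 0, 1] P = 0 := by
  unfold pivotPosRoots
  rw [Finset.card_eq_zero, Finset.filter_eq_empty_iff]
  intro u hu hpos
  rw [Multiset.mem_toFinset, Polynomial.mem_roots', Polynomial.IsRoot, Pivot.eval_det_pivot] at hu
  have h2 := hu.2
  rw [Matrix.det_fin_two] at h2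
  simp at h2
  exact absurd h2.1 hpos.ne'

/-- **THE OPEN CORE OF THE `m = 2` PIVOT LAW.**  If every CORE pencil `X^e • diag(−1,1) + ∑ₖ X^{dₖ} • Pₖ` — PSD letters,
no letter at the pivot exponent, exponents on both sides of the pivot, and every letter active `(Pₖ)₀₀ < (Pₖ)₁₁` — has at
most `2K` distinct positive determinant roots, then `PivotRootLawAt 2 K q (2K)` holds at every index `q`. [folklore] -/
theorem pivotRootLawAt_two_of_core (K q : ℕ)
    (h : ∀ (e : ℕ) (d : Fin K → ℕ) (P : Fin K → Matrix (Fin 2) (Fin 2) ℝ), (∀ k, (P k).PosSemidef) →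
      (∀ k, d k ≠ e) → (∃ k, d k < e) → (∃ k, e < d k) → (∀ k, P k 0 0 < P k 1 1) →
      pivotPosRoots e d !![-1, 0; 0, 1] P ≤ 2 * K) :
    PivotRootLawAt 2 K q (2 * K) := by
  refine TwoNormalForm.pivotRootLawAt_two_of_normalForm K q fun e d P hP => ?_
  rcases Nat.eq_zero_or_pos K with hK | hK
  · subst hK
    exact (posRoots_eq_zero_of_isEmpty e d P).le
  by_cases heq : ∃ k, d k = e
  · exact posRoots_le_two_mul_of_eq_pivot e d _ P hP heq
  push Not at heq
  by_cases hin : ∃ k, P k 1 1 ≤ P k 0 0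
  · exact posRoots_le_two_mul_of_inactive e d P hP heq hin
  push Not at hin
  by_cases hlow : ∃ k, d k < e
  · by_cases hhigh : ∃ k, e < d k
    · exact h e d P hP heq hlow hhigh hin
    · push Not at hhigh
      exact (posRoots_le_one_of_oneSided e d P hP (Or.inr hhigh)).trans (by omega)
  · push Not at hlow
    exact (posRoots_le_one_of_oneSided e d P hP (Or.inl hlow)).trans (by omega)

end Summit.ValiantsHypothesis.ValiantsHypothesis.Theorems.LacunarySymmetroidMatrixDescartes.Pivot.TwoCore
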